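import Summits.CriticalPhenomena.PercolationContinuityZ3.Theorems.Transplant.FKConnectivityAllQAntipodalX2SpineStep
import HarnessLib

/-!
# Connectivity correlation inequalities for `φ_{w,q}` — the spine of a marked edge, file 5: ONE GLUING STEP for the state of the
# MARKED PAIR (joined / straddling / dead)

Helper file (`--supports stmt-CriticalPhenomena-4575`), FK sub-lane `prim-bschramm-fk-2` (gen 14); builds on p205010 (kernel
theorem, internal audit signed; external expert review pending).  No definitions, no named facts, no sorries; standard axioms.

`FK.SpinePart.Glue.pairState_step`: for a gluing `p.Glue M a b a' b'`, vertices `u, v` of the inner composite `M` and a configuration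
`ω`, if the pair state `st` holds for `(ω ∩ M; a, b; u, v)` (`FK.PairState.Holds`: `J` = `u ↔ v`; `S` = `u ↮ v`, `u ↔ a`, `v ↔ b`;
`D` = `u ↮ v` even with `a, b` wired) then `runK st hd` holds for `(ω ∩ (M ∪ R); a', b'; u, v)`, `hd` the visible letter of the part
(memo g12 §1.4: parallel `S ↦ J` iff the part joins the terminals, series `S ↦ D` iff it does not; `J`, `D` absorbing).  The tool is
the two-terminal substitution lemma (`FK.reach_union_virtual`, `FK.reach_left_of_not_reach`, `FK.reach_left_of_inter_subset_singleton`):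
a part glued across the interface acts on the vertices of the inner composite like a switchable virtual edge.
[cite: Grimmett2006, §3.9 (p. 63)]
-/

namespace Summit.CriticalPhenomena.PercolationContinuityZ3.Theorems

namespace FK

open SimpleGraph Literature.Probability.LatticeModels Literature.Probability.Percolation X2Word
open scoped Classical

variable {V : Type*}

/-- The single edge `xy` lives on `{x, y}`. [folklore] -/
theorem pair_edges (x y : V) : ∀ e ∈ ({s(x, y)} : Set (Sym2 V)), ∀ z ∈ e, z ∈ ({x, y} : Set V) := by
  intro e he z hz
  rw [Set.mem_singleton_iff] at he; subst he
  rcases Sym2.mem_iff.1 hz with rfl | rfl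
  · exact Or.inl rfl
  · exact Or.inr rfl

/-- Inside a larger configuration. [folklore] -/
theorem coe_inter_mono_union (ω M R : Finset (Sym2 V)) : (↑(ω ∩ M) : Set (Sym2 V)) ⊆ ↑(ω ∩ (M ∪ R)) :=
  Finset.coe_subset.2 (Finset.inter_subset_inter subset_rfl Finset.subset_union_left)

/-- Inside a larger configuration (the part's side). [folklore] -/
theorem coe_inter_mono_union_right (ω M R : Finset (Sym2 V)) : (↑(ω ∩ R) : Set (Sym2 V)) ⊆ ↑(ω ∩ (M ∪ R)) :=
  Finset.coe_subset.2 (Finset.inter_subset_inter subset_rfl Finset.subset_union_right)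

section Step

variable {p : SpinePart V} {M : Finset (Sym2 V)} {a b a' b' u v : V}

/-- The joined state is absorbing. [folklore] -/
theorem SpinePart.Glue.pairState_step_J (ω : Finset (Sym2 V))
    (hst : PairState.J.Holds (↑(ω ∩ M) : BondConfig V) a b u v) (l : List Kind) :
    (runK .J l).Holds (↑(ω ∩ (M ∪ p.R)) : BondConfig V) a' b' u v := by
  rw [runK_J]
  simp only [PairState.Holds] at hst ⊢
  exact hst.mono (openGraph_mono (coe_inter_mono_union ω M p.R))

/-- The dead state is absorbing: a part glued across the interface acts like the virtual edge between the old terminals, and wiring the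
new terminals is no stronger. [folklore] -/
theorem SpinePart.Glue.pairState_step_D (hg : p.Glue M a b a' b') (hu : ∃ e ∈ M, u ∈ e) (hv : ∃ e ∈ M, v ∈ e)
    (ω : Finset (Sym2 V)) (hst : PairState.D.Holds (↑(ω ∩ M) : BondConfig V) a b u v) (l : List Kind) :
    (runK .D l).Holds (↑(ω ∩ (M ∪ p.R)) : BondConfig V) a' b' u v := by
  rw [runK_D]
  simp only [PairState.Holds] at hst ⊢
  intro h
  apply hst
  cases hg with
  | @par M R a b hR hd hV =>
    rw [coe_inter_union, Set.union_assoc] at h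
    have hS : {z : V | ∃ e ∈ M, z ∈ e} ∩ ({z : V | ∃ e ∈ R, z ∈ e} ∪ {a, b}) ⊆ ({a, b} : Set V) := by
      rintro z ⟨hzM, hzR | hz⟩
      · exact inter_span_subset_pair hV ⟨hzM, hzR⟩
      · exact hz
    exact reach_union_virtual (span_mem M) (span_mem_union_pair R a b) hS (coe_inter_subset ω M)
      (Set.union_subset_union_left _ (coe_inter_subset ω R)) hu hv h
  | @serA M R a b a' hR hd hV hb ha' =>
    rw [coe_inter_union, Set.union_assoc] at h
    have hS : {z : V | ∃ e ∈ M, z ∈ e} ∩ ({z : V | ∃ e ∈ R, z ∈ e} ∪ {a', b}) ⊆ ({a, b} : Set V) := by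
      rintro z ⟨hzM, hzR | hz⟩
      · exact Or.inl (hV z hzM hzR)
      · simp only [Set.mem_insert_iff, Set.mem_singleton_iff] at hz
        rcases hz with rfl | rfl
        · obtain ⟨e, he, hze⟩ := hzM; exact absurd hze (ha' e he)
        · exact Or.inr rfl
    exact reach_union_virtual (span_mem M) (span_mem_union_pair R a' b) hS (coe_inter_subset ω M)
      (Set.union_subset_union_left _ (coe_inter_subset ω R)) hu hv h
  | @serB M R a b b' hR hd hV ha hb' =>
    rw [coe_inter_union, Set.union_assoc] at h
    have hS : {z : V | ∃ e ∈ M, z ∈ e} ∩ ({z : V | ∃ e ∈ R, z ∈ e} ∪ {a, b'}) ⊆ ({a, b} : Set V) := by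
      rintro z ⟨hzM, hzR | hz⟩
      · exact Or.inr (hV z hzM hzR)
      · simp only [Set.mem_insert_iff, Set.mem_singleton_iff] at hz
        rcases hz with rfl | rfl
        · exact Or.inl rfl
        · obtain ⟨e, he, hze⟩ := hzM; exact absurd hze (hb' e he)
    exact reach_union_virtual (span_mem M) (span_mem_union_pair R a b') hS (coe_inter_subset ω M)
      (Set.union_subset_union_left _ (coe_inter_subset ω R)) hu hv h

/-- The straddling state: a joining parallel part joins the pair, a non-joining series part kills it, otherwise the pair keeps straddling
the new terminals. [folklore] -/
theorem SpinePart.Glue.pairState_step_S (hg : p.Glue M a b a' b') (hu : ∃ e ∈ M, u ∈ e) (hv : ∃ e ∈ M, v ∈ e)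
    (ω : Finset (Sym2 V)) (hst : PairState.S.Holds (↑(ω ∩ M) : BondConfig V) a b u v) :
    (runK .S (if rowVis p.kind (p.bit ω) then [p.kind] else [])).Holds (↑(ω ∩ (M ∪ p.R)) : BondConfig V) a' b' u v := by
  simp only [PairState.Holds] at hst
  obtain ⟨huv, hua, hvb⟩ := hst
  cases hg with
  | @par M R a b hR hd hV =>
    have m₁ := openGraph_mono (coe_inter_mono_union ω M R)
    have m₂ := openGraph_mono (coe_inter_mono_union_right ω M R)
    by_cases hr : (openGraph (↑(ω ∩ R) : BondConfig V)).Reachable a b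
    · have hbit : SpinePart.bit ⟨.P, R, a, b⟩ ω = true := SpinePart.bit_of_reach hr
      rw [hbit, visHead_P_true, runK_S_P]
      simp only [PairState.Holds]
      exact ((hua.mono m₁).trans (hr.mono m₂)).trans (hvb.mono m₁).symm
    · have hbit : SpinePart.bit ⟨.P, R, a, b⟩ ω = false := SpinePart.bit_of_not_reach hr
      rw [hbit, visHead_P_false, runK_nil]
      simp only [PairState.Holds]
      refine ⟨fun h => huv ?_, hua.mono m₁, hvb.mono m₁⟩
      rw [coe_inter_union] at h
      exact reach_left_of_not_reach (span_mem M) (span_mem R) (inter_span_subset_pair hV) (coe_inter_subset ω M)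
        (coe_inter_subset ω R) hr hu hv h
  | @serA M R a b a' hR hd hV hb ha' =>
    have m₁ := openGraph_mono (coe_inter_mono_union ω M R)
    have m₂ := openGraph_mono (coe_inter_mono_union_right ω M R)
    have hS1 : {z : V | ∃ e ∈ M, z ∈ e} ∩ {z : V | ∃ e ∈ R, z ∈ e} ⊆ ({a} : Set V) := fun z hz => hV z hz.1 hz.2
    by_cases hr : (openGraph (↑(ω ∩ R) : BondConfig V)).Reachable a a'
    · have hbit : SpinePart.bit ⟨.W, R, a, a'⟩ ω = true := SpinePart.bit_of_reach hr
      rw [hbit, visHead_W_true, runK_nil]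
      simp only [PairState.Holds]
      refine ⟨fun h => huv ?_, (hua.mono m₁).trans (hr.mono m₂), hvb.mono m₁⟩
      rw [coe_inter_union] at h
      exact reach_left_of_inter_subset_singleton (span_mem M) (span_mem R) hS1 (coe_inter_subset ω M)
        (coe_inter_subset ω R) hu hv h
    · have hbit : SpinePart.bit ⟨.W, R, a, a'⟩ ω = false := SpinePart.bit_of_not_reach hr
      rw [hbit, visHead_W_false, runK_S_W]
      simp only [PairState.Holds]
      intro h
      rw [coe_inter_union, Set.union_right_comm] at h
      -- the part is a closed switch between `a` and `a'`
      have hS2 : ({z : V | ∃ e ∈ M, z ∈ e} ∪ {a', b}) ∩ {z : V | ∃ e ∈ R, z ∈ e} ⊆ ({a, a'} : Set V) := by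
        rintro z ⟨hzM | hz, hzR⟩
        · exact Or.inl (hV z hzM hzR)
        · simp only [Set.mem_insert_iff, Set.mem_singleton_iff] at hz
          rcases hz with rfl | rfl
          · exact Or.inr rfl
          · obtain ⟨e, he, hze⟩ := hzR; exact absurd hze (hb e he)
      have h1 := reach_left_of_not_reach (span_mem_union_pair M a' b) (span_mem R) hS2
        (Set.union_subset_union_left _ (coe_inter_subset ω M)) (coe_inter_subset ω R) hr (Or.inl hu) (Or.inl hv) h
      -- the wiring edge `a'b` is pendant on `M`
      have hS3 : {z : V | ∃ e ∈ M, z ∈ e} ∩ ({a', b} : Set V) ⊆ ({b} : Set V) := by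
        rintro z ⟨hzM, hz⟩
        simp only [Set.mem_insert_iff, Set.mem_singleton_iff] at hz ⊢
        rcases hz with rfl | rfl
        · obtain ⟨e, he, hze⟩ := hzM; exact absurd hze (ha' e he)
        · rfl
      exact huv (reach_left_of_inter_subset_singleton (span_mem M) (pair_edges a' b) hS3 (coe_inter_subset ω M)
        subset_rfl hu hv h1)
  | @serB M R a b b' hR hd hV ha hb' =>
    have m₁ := openGraph_mono (coe_inter_mono_union ω M R)
    have m₂ := openGraph_mono (coe_inter_mono_union_right ω M R)
    have hS1 : {z : V | ∃ e ∈ M, z ∈ e} ∩ {z : V | ∃ e ∈ R, z ∈ e} ⊆ ({b} : Set V) := fun z hz => hV z hz.1 hz.2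
    by_cases hr : (openGraph (↑(ω ∩ R) : BondConfig V)).Reachable b b'
    · have hbit : SpinePart.bit ⟨.W, R, b, b'⟩ ω = true := SpinePart.bit_of_reach hr
      rw [hbit, visHead_W_true, runK_nil]
      simp only [PairState.Holds]
      refine ⟨fun h => huv ?_, hua.mono m₁, (hvb.mono m₁).trans (hr.mono m₂)⟩
      rw [coe_inter_union] at h
      exact reach_left_of_inter_subset_singleton (span_mem M) (span_mem R) hS1 (coe_inter_subset ω M)
        (coe_inter_subset ω R) hu hv h
    · have hbit : SpinePart.bit ⟨.W, R, b, b'⟩ ω = false := SpinePart.bit_of_not_reach hr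
      rw [hbit, visHead_W_false, runK_S_W]
      simp only [PairState.Holds]
      intro h
      rw [coe_inter_union, Set.union_right_comm] at h
      have hS2 : ({z : V | ∃ e ∈ M, z ∈ e} ∪ {a, b'}) ∩ {z : V | ∃ e ∈ R, z ∈ e} ⊆ ({b, b'} : Set V) := by
        rintro z ⟨hzM | hz, hzR⟩
        · exact Or.inl (hV z hzM hzR)
        · simp only [Set.mem_insert_iff, Set.mem_singleton_iff] at hz
          rcases hz with rfl | rfl
          · obtain ⟨e, he, hze⟩ := hzR; exact absurd hze (ha e he)
          · exact Or.inr rfl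
      have h1 := reach_left_of_not_reach (span_mem_union_pair M a b') (span_mem R) hS2
        (Set.union_subset_union_left _ (coe_inter_subset ω M)) (coe_inter_subset ω R) hr (Or.inl hu) (Or.inl hv) h
      have hS3 : {z : V | ∃ e ∈ M, z ∈ e} ∩ ({a, b'} : Set V) ⊆ ({a} : Set V) := by
        rintro z ⟨hzM, hz⟩
        simp only [Set.mem_insert_iff, Set.mem_singleton_iff] at hz ⊢
        rcases hz with rfl | rfl
        · rfl
        · obtain ⟨e, he, hze⟩ := hzM; exact absurd hze (hb' e he)
      exact huv (reach_left_of_inter_subset_singleton (span_mem M) (pair_edges a b') hS3 (coe_inter_subset ω M)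
        subset_rfl hu hv h1)

/-- **The marked pair after one gluing**: if the pair state `st` holds for `(ω ∩ M; a, b; u, v)` with `u, v` vertices of `M`, then
`runK st hd` holds for `(ω ∩ (M ∪ R); a', b'; u, v)`, `hd` the visible letter of the glued part. [folklore] -/
theorem SpinePart.Glue.pairState_step (hg : p.Glue M a b a' b') (hu : ∃ e ∈ M, u ∈ e) (hv : ∃ e ∈ M, v ∈ e)
    (ω : Finset (Sym2 V)) {st : PairState} (hst : st.Holds (↑(ω ∩ M) : BondConfig V) a b u v) :
    (runK st (if rowVis p.kind (p.bit ω) then [p.kind] else [])).Holds (↑(ω ∩ (M ∪ p.R)) : BondConfig V) a' b' u v := by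
  cases st with
  | J => exact SpinePart.Glue.pairState_step_J ω hst _
  | S => exact hg.pairState_step_S hu hv ω hst
  | D => exact hg.pairState_step_D hu hv ω hst _

end Step

end FK

end Summit.CriticalPhenomena.PercolationContinuityZ3.Theorems
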